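import Summits.ResolutionOfSingularities.KangarooAtlas.MizutaniLemma29Count
import Summits.ResolutionOfSingularities.KangarooAtlas.MizutaniLemma29Wave
import HarnessLib

/-!
# Mizutani's Lemma 2.9 (2) — the equality case `dim ker D = 2p`, assembled (tower form and field form)

Cell topic `Summits/ResolutionOfSingularities/KangarooAtlas` (pub-rosobs); namespace
`Summit.ResolutionOfSingularities.KangarooAtlas.Mizutani`.  Part of the Lean transcription of Mizutani 1973 §2
around the in-house note MIZUTANI-PROOF-g59 (AI-written, AI-audited; *AI review is weaker than expert review*; not a
resolution theorem).

Mizutani, Nagoya Math. J. 52 (1973), Lemma 2.9, p. 92–93: «Let `k ⊃ K ⊃ k^p` with `[K : k^p] = p²` and `p ≠ 2`, and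
let `D` be an element of `Diff₂(K/k^p)` with `D ≠ 0` and `D(1) = 0`.  Then (1) `dim_{k^p} ker(D) ≤ 2p`; (2) the
equality holds if and only if there exists `D₀ ∈ Der(K/k^p)` with the property `D₀(c₁) = 0` and `D₀(c₂) = 1` where
`k^p(c₁, c₂) = K`, such that `D = u·D₀²` with `u ∈ K`.»  Mizutani proves (2) only in outline («we use a primitive
method depending on complicated calculations, of which we indicate only an outline»).  This file assembles the five
cases proved in `MizutaniLemma29Cases/Count/Heat/Wave` (by the intrinsic normal form, the completed square, and base
change to `K ⊗_L K ≅ K[u]/(u^p)` with weighted initial forms) into: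

* **`IsRootTower.exists_normalForm_of_finrank_ker_eq`** — tower form, ⇒;
* **`IsRootTower.finrank_ker_eq_two_mul_iff`** — tower form, ⇔ (`p`-basis `(c₁, c₂)` = a root tower `IsRootTower L K p x' c`);
* `IsRootTower.exists_ker_eq_span_of_finrank_ker_eq` — in the equality case `ker D = L(c₁) ⊕ L(c₁)·c₂`
  (Mizutani's use in Thm. 2.8, Step (I): «`H` is of the same type as Example 2.1»);
* **`finrank_ker_eq_two_mul_iff_of_finrank_eq_sq`** — LEMMA 2.9 (2) AS PRINTED, for abstract fields `L ⊆ K` of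
  characteristic `p ≠ 2` with `[K : L] = p²` and `y^p ∈ L` for all `y`.

References: [Mizutani1973HironakaGroupSchemes] Lemma 2.9, p. 92–94.
-/

open MvPolynomial Literature.AlgebraicGeometry.Resolution
open scoped IntermediateField

namespace Summit.ResolutionOfSingularities.KangarooAtlas.Mizutani

universe u

section Equality

variable {L K : Type u} [Field L] [Field K] [Algebra L K] {p : ℕ} [hp : Fact p.Prime] [CharP K p]
  {x : Fin 2 → L} {a : Fin 2 → K}

/-- **MIZUTANI'S LEMMA 2.9 (2), ⇒, tower form.**  On a two-generator root tower `K = L(a₀, a₁)` of exponent `p ≠ 2`,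
an `L`-linear operator `D` of order `≤ 2` with `D 1 = D a₀ = D a₁ = 0` and `dim_L ker D = 2p` is `u·(D₀ ∘ D₀)` for a
derivation `D₀` of `K/L` and a `p`-basis `(c₁, c₂)` of `K/L` (a root tower) with `D₀ c₁ = 0`, `D₀ c₂ = 1`.  Proof by the
five cases on `(α, β, γ) = (D(a₀²), D(a₀a₁), D(a₁²))`: `γ = β = 0` (then `D = (α/2)∂₀²`); `γ = 0 ≠ β` (`dim ≤ 2p − 1`);
`αγ ≠ β²` (`dim ≤ 2p − 1`); `αγ = β²`, `w = 0` (then `D = (γ/2)D'²`); `αγ = β²`, `w ≠ 0` (`dim ≤ p`).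
[cite: Mizutani1973HironakaGroupSchemes, Lemma 2.9 (2), p. 93–94] -/
theorem IsRootTower.exists_normalForm_of_finrank_ker_eq (h : IsRootTower L K (p ^ 1) x a) (hp2 : p ≠ 2)
    {D : K →ₗ[L] K} (hD : IsDiffOpLE L 2 D) (h1 : D 1 = 0) (ha : ∀ i, D (a i) = 0)
    (hdim : Module.finrank L (LinearMap.ker D) = 2 * p) :
    ∃ (x' : Fin 2 → L) (c : Fin 2 → K) (_ : IsRootTower L K (p ^ 1) x' c) (D₀ : Derivation L K K) (u : K),
      D₀ (c 0) = 0 ∧ D₀ (c 1) = 1 ∧ D = u • ((D₀ : K →ₗ[L] K) ∘ₗ (D₀ : K →ₗ[L] K)) := by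
  have hp1 : 1 ≤ p := hp.out.one_lt.le
  by_cases hγ : D (a 1 ^ 2) = 0
  · by_cases hβ : D (a 0 * a 1) = 0
    · exact h.exists_normalForm_of_apply_eq_zero hp2 hD h1 ha hγ hβ
    · exfalso
      have := h.finrank_ker_le_of_sq_eq_zero_of_ne_zero hp2 hD h1 ha hγ hβ
      omega
  · by_cases hsq : D (a 0 ^ 2) * D (a 1 ^ 2) = D (a 0 * a 1) ^ 2
    · by_cases hw : (D (a 0 * a 1) / D (a 1 ^ 2)) * h.hsD (Finsupp.single 0 1) (D (a 0 * a 1) / D (a 1 ^ 2)) +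
          h.hsD (Finsupp.single 1 1) (D (a 0 * a 1) / D (a 1 ^ 2)) = 0
      · exact h.exists_normalForm_of_sq_of_eq_zero hp2 hD h1 ha hγ hsq hw hdim
      · exfalso
        have := h.finrank_ker_le_of_sq_of_ne_zero hp2 hD h1 ha hγ hsq hw
        omega
    · exfalso
      have := h.finrank_ker_le_of_not_sq hp2 hD h1 ha hγ hsq
      omega

/-- **MIZUTANI'S LEMMA 2.9 (2), tower form (⇔).**  `dim_L ker D = 2p` iff `D = u·(D₀ ∘ D₀)` for a derivation `D₀` of
`K/L`, `u ∈ K`, and a `p`-basis `(c₁, c₂)` of `K/L` with `D₀ c₁ = 0`, `D₀ c₂ = 1`.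
[cite: Mizutani1973HironakaGroupSchemes, Lemma 2.9 (2), p. 93] -/
theorem IsRootTower.finrank_ker_eq_two_mul_iff (h : IsRootTower L K (p ^ 1) x a) (hp2 : p ≠ 2) {D : K →ₗ[L] K}
    (hD : IsDiffOpLE L 2 D) (hD0 : D ≠ 0) (h1 : D 1 = 0) (ha : ∀ i, D (a i) = 0) :
    Module.finrank L (LinearMap.ker D) = 2 * p ↔
      ∃ (x' : Fin 2 → L) (c : Fin 2 → K) (_ : IsRootTower L K (p ^ 1) x' c) (D₀ : Derivation L K K) (u : K),
        D₀ (c 0) = 0 ∧ D₀ (c 1) = 1 ∧ D = u • ((D₀ : K →ₗ[L] K) ∘ₗ (D₀ : K →ₗ[L] K)) := by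
  constructor
  · exact h.exists_normalForm_of_finrank_ker_eq hp2 hD h1 ha
  · rintro ⟨x', c, h', D₀, u, hc0, hc1, hDeq⟩
    have hu : u ≠ 0 := by
      rintro rfl
      exact hD0 (by rw [hDeq, zero_smul])
    exact h'.finrank_ker_eq_two_mul_of_eq_smul_comp hp2 D₀ hc0 hc1 hu hDeq

/-- **The kernel in the equality case**: if `dim_L ker D = 2p` then for the `p`-basis `(c₁, c₂)` of the normal form,
`ker D = L(c₁) ⊕ L(c₁)·c₂` — the `L`-span of the monomials `c₁^m c₂^j`, `j ≤ 1`.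
[cite: Mizutani1973HironakaGroupSchemes, Lemma 2.9 (2) and Theorem 2.8 (proof, Step (I): «the same type as Example 2.1»)] -/
theorem IsRootTower.exists_ker_eq_span_of_finrank_ker_eq (h : IsRootTower L K (p ^ 1) x a) (hp2 : p ≠ 2)
    {D : K →ₗ[L] K} (hD : IsDiffOpLE L 2 D) (hD0 : D ≠ 0) (h1 : D 1 = 0) (ha : ∀ i, D (a i) = 0)
    (hdim : Module.finrank L (LinearMap.ker D) = 2 * p) :
    ∃ (x' : Fin 2 → L) (c : Fin 2 → K) (_ : IsRootTower L K (p ^ 1) x' c) (D₀ : Derivation L K K) (u : K),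
      D₀ (c 0) = 0 ∧ D₀ (c 1) = 1 ∧ D = u • ((D₀ : K →ₗ[L] K) ∘ₗ (D₀ : K →ₗ[L] K)) ∧
      LinearMap.ker D = Submodule.span L (Set.range fun mj : Fin p × Fin 2 => c 0 ^ (mj.1 : ℕ) * c 1 ^ (mj.2 : ℕ)) := by
  obtain ⟨x', c, h', D₀, u, hc0, hc1, hDeq⟩ := h.exists_normalForm_of_finrank_ker_eq hp2 hD h1 ha hdim
  have hu : u ≠ 0 := by
    rintro rfl
    exact hD0 (by rw [hDeq, zero_smul])
  exact ⟨x', c, h', D₀, u, hc0, hc1, hDeq, h'.ker_eq_span_of_eq_smul_comp hp2 D₀ hc0 hc1 hu hDeq⟩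

/-! ### Lemma 2.9 (2) as printed -/

omit [CharP K p] in
/-- If `dim_L ker D > p` (with `D 1 = 0`, `[K : L] = p²`, `y^p ∈ L`) then `ker D` contains a `p`-basis of `K/L`: there
is a root tower `K = L(t₀, t₁)` with `t_i ∈ ker D`. [cite: Mizutani1973HironakaGroupSchemes, Lemma 2.9 (proof, p. 93)] -/
theorem exists_isRootTower_of_lt_finrank_ker [FiniteDimensional L K] (hdim : Module.finrank L K = p ^ 2)
    (hpow : ∀ y : K, y ^ p ∈ Set.range (algebraMap L K)) (D : K →ₗ[L] K)
    (hlt : p < Module.finrank L (LinearMap.ker D)) :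
    ∃ (x : Fin 2 → L) (t : Fin 2 → K), IsRootTower L K (p ^ 1) x t ∧ ∀ i, D (t i) = 0 := by
  classical
  set T := LinearMap.ker D with hT
  set E := IntermediateField.adjoin L (T : Set K) with hE
  have hTE : T ≤ E.toSubalgebra.toSubmodule := fun y hy => IntermediateField.subset_adjoin L _ hy
  -- `T` generates `K`: otherwise `dim T ≤ p`
  have htop : E = ⊤ := by
    by_contra hne
    have hdvd : Module.finrank L E ∣ p ^ 2 := by
      rw [← hdim, ← Module.finrank_mul_finrank L E K]
      exact Dvd.intro _ rfl
    obtain ⟨k, hk, hkeq⟩ := (Nat.dvd_prime_pow hp.out).mp hdvd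
    have hEle : Module.finrank L E ≤ p := by
      interval_cases k
      · rw [hkeq, pow_zero]; exact hp.out.one_lt.le
      · rw [hkeq, pow_one]
      · exfalso
        apply hne
        refine IntermediateField.eq_of_le_of_finrank_eq le_top ?_
        rw [hkeq, IntermediateField.finrank_top', hdim]
    have : Module.finrank L T ≤ p :=
      le_trans (Submodule.finrank_mono hTE) hEle
    omega
  have hT1 : ¬ (T : Set K) ⊆ ((⊥ : IntermediateField L K) : Set K) := by
    intro hsub
    have hle : E ≤ ⊥ := IntermediateField.adjoin_le_iff.mpr hsub
    have hbot : (⊥ : IntermediateField L K) = ⊤ := le_antisymm le_top (htop ▸ hle)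
    have h1' := IntermediateField.finrank_eq_one_iff.mpr hbot.symm
    rw [IntermediateField.finrank_top', hdim] at h1'
    have := hp.out.one_lt
    nlinarith
  obtain ⟨t₁, ht₁T, ht₁⟩ := Set.not_subset.mp hT1
  have ht₁' : t₁ ∉ (⊥ : IntermediateField L K) := ht₁
  have hT2 : ¬ (T : Set K) ⊆ (L⟮t₁⟯ : Set K) := by
    intro hsub
    have hle : E ≤ L⟮t₁⟯ := IntermediateField.adjoin_le_iff.mpr hsub
    rw [htop, top_le_iff] at hle
    have hpdeg := finrank_adjoin_simple_eq_of_pow_mem hdim ht₁' (hpow t₁)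
    rw [hle, IntermediateField.finrank_top', hdim] at hpdeg
    have h1 := hp.out.one_lt
    have : p ^ 2 = p * p := sq p
    nlinarith
  obtain ⟨t₂, ht₂T, ht₂⟩ := Set.not_subset.mp hT2
  have ht₂' : t₂ ∉ L⟮t₁⟯ := ht₂
  set t : Fin 2 → K := ![t₁, t₂] with ht
  choose xf hxf using hpow
  set x : Fin 2 → L := fun i => xf (t i) with hx
  have hxt : ∀ i, t i ^ p = algebraMap L K (x i) := fun i => (hxf (t i)).symm
  refine ⟨x, t, isRootTower_pair hdim hxt (by simpa [ht] using ht₁') (by simpa [ht] using ht₂'), fun i => ?_⟩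
  fin_cases i
  · simpa [ht] using LinearMap.mem_ker.mp ht₁T
  · simpa [ht] using LinearMap.mem_ker.mp ht₂T

/-- **MIZUTANI'S LEMMA 2.9 (2), as printed.**  `L ⊆ K` fields of characteristic `p ≠ 2` with `[K : L] = p²` and
`y^p ∈ L` for every `y ∈ K`; `D : K → K` an `L`-linear differential operator of order `≤ 2` with `D ≠ 0`, `D 1 = 0`.
Then `dim_L ker D = 2p` if and only if there are a derivation `D₀` of `K/L`, `u ∈ K`, and `c₁, c₂` with `K = L(c₁, c₂)`
(a `p`-basis, i.e. a root tower) such that `D₀ c₁ = 0`, `D₀ c₂ = 1` and `D = u·(D₀ ∘ D₀)`.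
[cite: Mizutani1973HironakaGroupSchemes, Lemma 2.9 (2), p. 92–93] -/
theorem finrank_ker_eq_two_mul_iff_of_finrank_eq_sq [FiniteDimensional L K] (hp2 : p ≠ 2)
    (hdim : Module.finrank L K = p ^ 2) (hpow : ∀ y : K, y ^ p ∈ Set.range (algebraMap L K)) (D : K →ₗ[L] K)
    (hD : IsDiffOpLE L 2 D) (hD0 : D ≠ 0) (h1 : D 1 = 0) :
    Module.finrank L (LinearMap.ker D) = 2 * p ↔
      ∃ (x' : Fin 2 → L) (c : Fin 2 → K) (_ : IsRootTower L K (p ^ 1) x' c) (D₀ : Derivation L K K) (u : K),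
        D₀ (c 0) = 0 ∧ D₀ (c 1) = 1 ∧ D = u • ((D₀ : K →ₗ[L] K) ∘ₗ (D₀ : K →ₗ[L] K)) := by
  constructor
  · intro hdimker
    have hlt : p < Module.finrank L (LinearMap.ker D) := by
      rw [hdimker]; have := hp.out.one_lt; omega
    obtain ⟨x, t, h, ht⟩ := exists_isRootTower_of_lt_finrank_ker hdim hpow D hlt
    exact h.exists_normalForm_of_finrank_ker_eq hp2 hD h1 ht hdimker
  · rintro ⟨x', c, h', D₀, u, hc0, hc1, hDeq⟩
    have hu : u ≠ 0 := by
      rintro rfl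
      exact hD0 (by rw [hDeq, zero_smul])
    exact h'.finrank_ker_eq_two_mul_of_eq_smul_comp hp2 D₀ hc0 hc1 hu hDeq

end Equality

end Summit.ResolutionOfSingularities.KangarooAtlas.Mizutani
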